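import Summits.QuantumFields.BalabanUV.T4Continuum.Support.RegionGaugeResolventTower
import Summits.QuantumFields.BalabanUV.T4Continuum.Support.RegionStarInjectedPairing
import Summits.QuantumFields.BalabanUV.T4Continuum.Support.RegionStarPairingBricks
import Summits.QuantumFields.BalabanUV.T4Continuum.Support.RegionInteriorGaffney

/-!
# T⁴ programme, spine node NE2 (U1a), sub-row Δ1 «NE2⁰-Dirichlet» — THE (L)-LEAF OF THE RESOLVENT SPLIT REDUCED TO A TWO-LEVEL
# COMMUTATOR PAIRING OF THE LOCAL OPERATOR with budgets for `G̃ = Δ_loc(Ω₀)⁻¹`, whose energy and interior-W2 budgets are theorems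
# (owner item O15-b «Δ1-VEC-W3-LOCAL-PAIRING»)

Row NE2 OWNER (unit `b2b-balaban-t4-ne2-p1`, gen 15), on O15-a (`Support/RegionGaugeResolventSplit` p238371, `Support/RegionGaugeResolventTower`):
ruling R35 (journal 2026-08-20 l.22128) re-cut the last box binder `hinjK` into (L) ∧ (B) ∧ (Bᵗ) ∧ (K); (L) — the injected law of the LOCAL
operator `Δ_loc(Ω₀) = curlRᴴcurlR + ∂_Ω∂_Ωᴴ + a n^d·avgRᴴavgR` — keeps gen 14's (P) + (R) decomposition (R33/R34), now with budgets for
`G̃ = Δ_loc(Ω₀)⁻¹` instead of the gauge-fixed propagator.  THIS FILE is that junction (bookkeeping, gen 14's `RegionStarInjectedPairing`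
pattern with `regionDeltaLoc` for `regionDeltaA`):

 * §1 W1 for the local operator on boxes BY NAME: `coercive_regionDeltaLoc_lev_box` (γ⋆ = `gamStar d a′ (cW1box d a a′ 4)` at every level,
   from the owner's `sliceCoercive_lev_box` through `coercive_regionDeltaLoc_of`), invertibility, ‖G̃_k‖ ≤ γ⋆⁻¹.
 * §2 (R̃-energy) and (R̃-W2) ARE THEOREMS: `energy_budget_loc` (`√Re⟨G̃f, Δ_loc G̃f⟩ ≤ √(γ⁻¹)·√nsq f`), **`interiorW2_loc`**
   (`Σ_μ ‖igrad_μ A‖² ≤ Re⟨A, Δ_loc A⟩` with CONSTANT 1 on every `AtMostOneNeighbour` region, `0 ≤ a` — `form_localFixed` + leaf-07-g7's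
   `interior_gaffney`), `igrad_budget_loc` (`√(Σ_μ ‖igrad_μ (G̃f)‖²) ≤ √(γ⁻¹)·√nsq f`).  The interior-Hessian budget (R-loc) is leaf-02-g8's
   «Δ1-LOC-HESS» (R35 (c)); the pairing (P̃) = (P-gaffney) [leaf-03-g8] + (P-mass) [leaf-07-g8].
 * §3 **`hloc_of_pairing`**: (P̃) `‖⟨v, (J·Δ_loc^{(k)} − Δ_loc^{(k+1)}·J)u⟩‖ ≤ ε_k√E_k(u)√E′_k(v)` + (R̃) `√E_k(G̃_k f) ≤ Λ_k√nsq f`,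
   `√E′_k(G̃_{k+1} g) ≤ Λ′_k√nsq g` + `ε_kΛ_kΛ′_k ≤ Cl·θ^k` ⟹ leaf (L) `hloc` of `RegionGaugeResolventTower.hinjK_of_local`; and the END
   **`towerLimitRate_star_renorm_box_of_localPairing`** = O15-a's `towerLimitRate_star_renorm_box_of_local` with (L) discharged from (P̃)+(R̃).

HONEST FRAMING (T4-DAG p. 1).  Bookkeeping over landed modules ([folklore]); model level (`U = 1`, ONE region = a coordinate box, ONE averaging
scale, finite torus, linear layer, operator norm); (P̃), the Hessian half of (R̃), (B), (Bᵗ), (K) are DISPLAYED, not proved; `hinjK` / W3 on boxes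
OPEN; NE2 (U1a) NOT proved; spine PROVED 0/9 unchanged; NOT [B9] (3.16)/(3.23)–(3.27)/(3.42) as printed; NOT infinite volume / mass gap / Clay.
HONEST DEPENDENCY: continuum YM on T⁴ ⇐ BetaPertH ∧ nine spine estimates (0/9 proved); BetaPertH ⇐ (D1) ∧ (D4) ∧ CAP+tail; G-an2-4 gates
asym, D1 and NE2/3/4.  No `sorry`.
-/

noncomputable section

open scoped BigOperators ComplexConjugate Matrix Matrix.Norms.L2Operator

namespace Summit.QuantumFields.BalabanUV.T4Continuum.RegionLocalInjectedPairing

open Literature.MathematicalPhysics.QuantumFieldTheory.Balaban1983to89.B5Prop11Plancherel (Tor fine)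
open Literature.MathematicalPhysics.QuantumFieldTheory.Balaban1983to89.B5Prop11Lower (nsq nsq_nonneg)
open Literature.MathematicalPhysics.QuantumFieldTheory.Balaban1983to89.B5G183RateUnitTower (lev)
open Summit.QuantumFields.BalabanUV.T4Continuum
open Summit.QuantumFields.BalabanUV.T4Continuum.SubtypeCompression (Coercive isUnit_det_of_coercive opNorm_inv_le_of_coercive)
open Summit.QuantumFields.BalabanUV.T4Continuum.CovariantAveragingTower (TowerLimitRate)
open Summit.QuantumFields.BalabanUV.T4Continuum.BackgroundResolventTower (Cpert)
open Summit.QuantumFields.BalabanUV.T4Continuum.ScalarAveragedPropagator (re_star_dotProduct_le)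
open Summit.QuantumFields.BalabanUV.T4Continuum.RegionScalarCompression (KcompR)
open Summit.QuantumFields.BalabanUV.T4Continuum.RegionGaugeFixedVector (starReg curlR gradR avgR regionDeltaA)
open Summit.QuantumFields.BalabanUV.T4Continuum.RegionStarBoundaryCharges (AtMostOneNeighbour atMostOneNeighbour_of_isCoordBox)
open Summit.QuantumFields.BalabanUV.T4Continuum.RegionInteriorGaffney (interior_gaffney)
open Summit.QuantumFields.BalabanUV.T4Continuum.DirichletSubregionTowerOf (pidx JpR opNorm_JpR_le)
open Summit.QuantumFields.BalabanUV.T4Continuum.DirichletSubregionRenormTower (AnR)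
open Summit.QuantumFields.BalabanUV.T4Continuum.DirichletStarVectorTower (starP gamStar gamStar_pos coercive_regionDeltaA_of_slice)
open Summit.QuantumFields.BalabanUV.T4Continuum.DirichletStarRenormTower (igrad)
open Summit.QuantumFields.BalabanUV.T4Continuum.RegionInteriorW2 (CgIbox)
open Summit.QuantumFields.BalabanUV.T4Continuum.RegionSliceCoerciveBoxTower (cW1box cW1box_pos)
open Summit.QuantumFields.BalabanUV.T4Continuum.RegionSliceCoerciveBox (sliceCoercive_lev_box)
open Summit.QuantumFields.BalabanUV.T4Continuum.RegionStarInjectedPairing (opNorm_injected_le_of_pairing)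
open Summit.QuantumFields.BalabanUV.T4Continuum.RegionStarPairingBricks (energy_budget_of_coercive)
open Summit.QuantumFields.BalabanUV.T4Continuum.RegionGaugeResolventSplit
open Summit.QuantumFields.BalabanUV.T4Continuum.RegionGaugeResolventTower (C1loc hinjK_of_local towerLimitRate_star_renorm_box_of_local)
open Summit.QuantumFields.BalabanUV.Beta.GAN24.DirichletBoxTwoLevel (IsCoordBox)

variable {d : ℕ}

/-! ## §1 W1 for the local operator, per level and along the tower -/

section Level

variable (n : ℕ) [NeZero n] (M : Fin d → ℕ) [hM : ∀ μ, NeZero (M μ)] (a a' : ℝ) (S : Tor M → Prop) [DecidablePred S]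

/-- **(R̃-ENERGY) IS A THEOREM**: `Coercive Δ_a(Ω₀) γ` (`0 < a′`) ⟹ for `u = G̃f`, `√(Re⟨u, Δ_loc u⟩) ≤ √(γ⁻¹)·√nsq f`. [folklore] -/
theorem energy_budget_loc (ha' : 0 < a') {γ : ℝ} (hγ : 0 < γ) (hco : Coercive (regionDeltaA n M a a' S) γ)
    (f : {b // starReg n M S b} → ℂ) :
    Real.sqrt ((star ((regionDeltaLoc n M a S)⁻¹ *ᵥ f) ⬝ᵥ (regionDeltaLoc n M a S *ᵥ ((regionDeltaLoc n M a S)⁻¹ *ᵥ f))).re)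
      ≤ Real.sqrt γ⁻¹ * Real.sqrt (nsq f) :=
  energy_budget_of_coercive hγ (coercive_regionDeltaLoc_of n M a a' S ha' hco) f

/-- **(R̃-W2) IS A THEOREM, CONSTANT 1**: on every `AtMostOneNeighbour` region (`0 ≤ a`), `Σ_μ ‖igrad_μ A‖² ≤ Re⟨A, Δ_loc(Ω₀) A⟩` — the
local form is `‖curl A‖² + ‖∂_ΩᴴA‖² + a n^d‖QA‖²` (`form_localFixed`) and leaf-07-g7's interior Gaffney bounds the interior differences by
its first two terms. [folklore] -/
theorem interiorW2_loc (hH : AtMostOneNeighbour n M S) (ha : 0 ≤ a) (A : {b // starReg n M S b} → ℂ) :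
    ∑ μ, nsq (igrad M S n μ A) ≤ (star A ⬝ᵥ (regionDeltaLoc n M a S *ᵥ A)).re := by
  rw [regionDeltaLoc, form_localFixed]
  have h1 := interior_gaffney n M S hH A
  have h2 : 0 ≤ a * (n : ℝ) ^ d * nsq (avgR n M S *ᵥ A) :=
    mul_nonneg (mul_nonneg ha (pow_nonneg (Nat.cast_nonneg _) d)) (nsq_nonneg _)
  linarith

/-- the same on a coordinate box at every level `n ≥ 2`. [folklore] -/
theorem interiorW2_loc_box (hn : 2 ≤ n) (hS : IsCoordBox M S) (ha : 0 ≤ a) (A : {b // starReg n M S b} → ℂ) :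
    ∑ μ, nsq (igrad M S n μ A) ≤ (star A ⬝ᵥ (regionDeltaLoc n M a S *ᵥ A)).re :=
  interiorW2_loc n M a S (atMostOneNeighbour_of_isCoordBox n M S hn hS) ha A

/-- **THE INTERIOR-GRADIENT BUDGET OF `G̃`**: `AtMostOneNeighbour`, `0 ≤ a`, `0 < a′`, `Coercive Δ_a(Ω₀) γ` ⟹
`√(Σ_μ ‖igrad_μ (G̃f)‖²) ≤ √(γ⁻¹)·√nsq f`. [folklore] -/
theorem igrad_budget_loc (hH : AtMostOneNeighbour n M S) (ha : 0 ≤ a) (ha' : 0 < a') {γ : ℝ} (hγ : 0 < γ)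
    (hco : Coercive (regionDeltaA n M a a' S) γ) (f : {b // starReg n M S b} → ℂ) :
    Real.sqrt (∑ μ, nsq (igrad M S n μ ((regionDeltaLoc n M a S)⁻¹ *ᵥ f))) ≤ Real.sqrt γ⁻¹ * Real.sqrt (nsq f) :=
  (Real.sqrt_le_sqrt (interiorW2_loc n M a S hH ha _)).trans (energy_budget_loc n M a a' S ha' hγ hco f)

end Level

section Tower

variable (L : ℕ) [NeZero L] (M : Fin d → ℕ) [hM : ∀ μ, NeZero (M μ)] (S : Tor M → Prop) [DecidablePred S] (a a' : ℝ)

/-- **W1 FOR THE LOCAL OPERATOR ALONG THE BOX TOWER**: `Coercive (Δ_loc^{(k)}(Ω₀)) γ⋆` at every level, `γ⋆ = gamStar d a′ (cW1box d a a′ 4)`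
(the owner's `sliceCoercive_lev_box` through `Δ_a ≤ Δ_loc`). [folklore] -/
theorem coercive_regionDeltaLoc_lev_box (hL : 2 ≤ L) (hbox : IsCoordBox M S) (ha : 0 < a) (ha' : 0 < a') (k : ℕ) :
    Coercive (regionDeltaA (lev L k) M a a' S) (gamStar d a' (cW1box d a a' 4)) ∧
      Coercive (regionDeltaLoc (lev L k) M a S) (gamStar d a' (cW1box d a a' 4)) := by
  have hc := cW1box_pos (d := d) a a' (Cf := 4) ha ha'
  have h := coercive_regionDeltaA_of_slice (lev L k) M a a' S ha' hc (sliceCoercive_lev_box M a a' S L hL hbox ha ha' k)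
  exact ⟨h, coercive_regionDeltaLoc_of (lev L k) M a a' S ha' h⟩

/-- hence `G̃_k` exists with `‖G̃_k‖ ≤ γ⋆⁻¹` at every level. [folklore] -/
theorem opNorm_inv_regionDeltaLoc_lev_box_le (hL : 2 ≤ L) (hbox : IsCoordBox M S) (ha : 0 < a) (ha' : 0 < a') (k : ℕ) :
    IsUnit (regionDeltaLoc (lev L k) M a S).det ∧ ‖(regionDeltaLoc (lev L k) M a S)⁻¹‖ ≤ (gamStar d a' (cW1box d a a' 4))⁻¹ :=
  opNorm_inv_regionDeltaLoc_le (lev L k) M a a' S ha' (gamStar_pos (d := d) a' (cW1box_pos (d := d) a a' (Cf := 4) ha ha'))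
    (coercive_regionDeltaLoc_lev_box L M S a a' hL hbox ha ha' k).1

/-! ## §3 Leaf (L) from a commutator pairing of the LOCAL operator with budgets, and the END -/

/-- **LEAF (L) FROM (P̃) + (R̃)** along the box star tower (`2 ≤ L`, `0 < a`, `0 < a′`): pairing constants `ε_k`, budget bounds `Λ_k`, `Λ′_k`
with `ε_k·Λ_k·Λ′_k ≤ Cl·θ^k` ⟹ `‖G̃_{k+1}·JpR k − JpR k·G̃_k‖ ≤ Cl·θ^k`. [folklore] -/
theorem hloc_of_pairing (hL : 2 ≤ L) (hbox : IsCoordBox M S) (ha : 0 < a) (ha' : 0 < a')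
    {E : (k : ℕ) → (pidx L M (starP L M S) k → ℂ) → ℝ} {E' : (k : ℕ) → (pidx L M (starP L M S) (k + 1) → ℂ) → ℝ}
    {ε Λ Λ' : ℕ → ℝ} (hε : ∀ k, 0 ≤ ε k) (hΛ : ∀ k, 0 ≤ Λ k) (hΛ' : ∀ k, 0 ≤ Λ' k)
    (hP : ∀ (k : ℕ) (u : pidx L M (starP L M S) k → ℂ) (v : pidx L M (starP L M S) (k + 1) → ℂ),
      ‖star v ⬝ᵥ ((JpR L M (starP L M S) k * regionDeltaLoc (lev L k) M a S
          - regionDeltaLoc (lev L (k + 1)) M a S * JpR L M (starP L M S) k) *ᵥ u)‖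
        ≤ ε k * Real.sqrt (E k u) * Real.sqrt (E' k v))
    (hR : ∀ (k : ℕ) (f : pidx L M (starP L M S) k → ℂ),
      Real.sqrt (E k ((regionDeltaLoc (lev L k) M a S)⁻¹ *ᵥ f)) ≤ Λ k * Real.sqrt (nsq f))
    (hR' : ∀ (k : ℕ) (g : pidx L M (starP L M S) (k + 1) → ℂ),
      Real.sqrt (E' k ((regionDeltaLoc (lev L (k + 1)) M a S)⁻¹ *ᵥ g)) ≤ Λ' k * Real.sqrt (nsq g))
    {Cl θ : ℝ} (hrate : ∀ k, ε k * Λ k * Λ' k ≤ Cl * θ ^ k) (k : ℕ) :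
    ‖(regionDeltaLoc (lev L (k + 1)) M a S)⁻¹ * JpR L M (starP L M S) k
        - JpR L M (starP L M S) k * (regionDeltaLoc (lev L k) M a S)⁻¹‖ ≤ Cl * θ ^ k :=
  (opNorm_injected_le_of_pairing (regionDeltaLoc_isHermitian (lev L (k + 1)) M a S)
    (opNorm_inv_regionDeltaLoc_lev_box_le L M S a a' hL hbox ha ha' (k + 1)).1
    (opNorm_inv_regionDeltaLoc_lev_box_le L M S a a' hL hbox ha ha' k).1
    (JpR L M (starP L M S) k) (hε k) (hΛ k) (hΛ' k) (hP k) (hR k) (hR' k)).trans (hrate k)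

/-- **THE RENORMALISED STAR TOWER OF THE FAITHFUL `Δ_a(Ω₀)` ON A COORDINATE BOX AT RATE `θ ∈ [(√L)⁻¹, 1)` MODULO (P̃) + (R̃) FOR THE LOCAL
OPERATOR AND THE GAUGE-COLUMN LEAVES (B)(Bᵗ)(K)** — O15-a's `towerLimitRate_star_renorm_box_of_local` with (L) discharged by
`hloc_of_pairing`. [folklore] -/
theorem towerLimitRate_star_renorm_box_of_localPairing (hL : 2 ≤ L) (hbox : IsCoordBox M S) (ha : 0 < a) (ha' : 0 < a')
    {θ : ℝ} (hθ : (Real.sqrt L)⁻¹ ≤ θ) (hθ1 : θ < 1)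
    {E : (k : ℕ) → (pidx L M (starP L M S) k → ℂ) → ℝ} {E' : (k : ℕ) → (pidx L M (starP L M S) (k + 1) → ℂ) → ℝ}
    {ε Λ Λ' : ℕ → ℝ} (hε : ∀ k, 0 ≤ ε k) (hΛ : ∀ k, 0 ≤ Λ k) (hΛ' : ∀ k, 0 ≤ Λ' k)
    (hP : ∀ (k : ℕ) (u : pidx L M (starP L M S) k → ℂ) (v : pidx L M (starP L M S) (k + 1) → ℂ),
      ‖star v ⬝ᵥ ((JpR L M (starP L M S) k * regionDeltaLoc (lev L k) M a S
          - regionDeltaLoc (lev L (k + 1)) M a S * JpR L M (starP L M S) k) *ᵥ u)‖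
        ≤ ε k * Real.sqrt (E k u) * Real.sqrt (E' k v))
    (hR : ∀ (k : ℕ) (f : pidx L M (starP L M S) k → ℂ),
      Real.sqrt (E k ((regionDeltaLoc (lev L k) M a S)⁻¹ *ᵥ f)) ≤ Λ k * Real.sqrt (nsq f))
    (hR' : ∀ (k : ℕ) (g : pidx L M (starP L M S) (k + 1) → ℂ),
      Real.sqrt (E' k ((regionDeltaLoc (lev L (k + 1)) M a S)⁻¹ *ᵥ g)) ≤ Λ' k * Real.sqrt (nsq g))
    {Cl Cb Cbt Ck : ℝ} (hrate : ∀ k, ε k * Λ k * Λ' k ≤ Cl * θ ^ k) (hCb : 0 ≤ Cb)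
    (hB : ∀ k, ‖regionBh (lev L (k + 1)) M a' S - JpR L M (starP L M S) k * regionBh (lev L k) M a' S‖ ≤ Cb * θ ^ k)
    (hBt : ∀ k, ‖(JpR L M (starP L M S) k)ᴴ * regionBh (lev L (k + 1)) M a' S - regionBh (lev L k) M a' S‖ ≤ Cbt * θ ^ k)
    (hK : ∀ k, ‖(KcompR (lev L (k + 1)) M a' S)⁻¹ - (KcompR (lev L k) M a' S)⁻¹‖ ≤ Ck * θ ^ k) :
    TowerLimitRate (AnR L M (starP L M S)) ((L : ℝ) ^ d) (fun k => (regionDeltaA (lev L k) M a a' S)⁻¹)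
      (Cpert 0 (Real.sqrt (CgIbox d a' (cW1box d a a' 4) / 2 * (gamStar d a' (cW1box d a a' 4))⁻¹))
        (Real.sqrt L * C1loc d a a' Cl Cb Cbt Ck + (2 * (Real.sqrt L - 1) * Real.sqrt ((2 * (gamStar d a' (cW1box d a a' 4))⁻¹
          + CgIbox d a' (cW1box d a a' 4)) * (gamStar d a' (cW1box d a a' 4))⁻¹))) 0 0 0) θ :=
  towerLimitRate_star_renorm_box_of_local L M S a a' hL hbox ha ha' hθ hθ1 hCb
    (hloc_of_pairing L M S a a' hL hbox ha ha' hε hΛ hΛ' hP hR hR' hrate) hB hBt hK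

end Tower

end Summit.QuantumFields.BalabanUV.T4Continuum.RegionLocalInjectedPairing

end
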